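import Summits.Schanuel.Schanuel.Theorems.RootDecomp1BAlgFrame04

/-!
# RootDecomp1BAlgFrame — lens 4, generation 40 «UNBOUNDED-DEGREE FRAMES» (lane B-R24 (b′), PRICE B-β, RULE B-R26): X(2) and the three At-cells at (1 | ρ) for every ρ in the class `AlgUltraLiouville` (doubly-exponential hyper-approximation by real algebraic irrationals of UNBOUNDED degree) modulo `Roy2014_thm_1_1` ONLY — the degree a running parameter of Roy's point-explicit L–W measure (budget lemma `algFrameMeasure_explicit_of_roy` with the floor exp(−royC D·exp(A^8)·(1+log H)) in its TYPE); the NAMED MEMBER ρ_A (a tower over 2^{1/p}, prime degrees p → ∞) with HYPOTHESIS-FREE membership, degree certificate [ℚ(β_K):ℚ] = g_K, position certificate |ρ_A − γ| ≥ exp(−A⁴) and the exclusions BY TREE NAMES (¬Hyper, ¬QuadHyper, ¬Ultra ×2, ¬LiouvilleOrder 8, transcendental) — continuation (RootDecomp1BAlgFrame05): §M.4–§M.5 increments, the limit rhoA, membership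

(lens-4 g40 HOME kernel AlgFrame.lean fe3f4606…, 1974 l, imports tree RootDecomp1BQuadFrame05 + RootDecomp1EPointTransfer04 only; CLAIM L2078, RULING + CHECKLIST B-g40 L2080, NODE L2101 / REQUEST L2102 / RESULT L2103, critic VERDICT L2111 (crit g9: (A) CLEARED — ONE CELL (B-β); lens-4 tally THEOREM ×6 + CELL ×3; RULE B-R26 in force (the Roy-transfer line on 1B CLOSED); PORT GO 01–09 `--supports stmt-Schanuel-24622`); port by census-1 gen 18 as `RootDecomp1BAlgFrame01`–`09` along K's sections: 01 = §D the class `AlgUltraLiouville` + the measure shape `AlgFrameMeasure` + §R helpers (`royC`); 02 = §R the budget lemma `algFrameMeasure_explicit_of_roy` (Roy ⟹ the algebraic frame measure in EVERY degree; scoped `maxHeartbeats 1600000` carried as in K); 03 = §E the engine `algebraicIndependent_exp_frame_of_algUltraLiouville (hRoy)` + the `![…]` forms; 04 = §M.1–§M.3 prime degrees `gdeg`, radicals `theta`, frame data `Nseq`/`Pseq`/`fd` (with `attribute [irreducible] fd`), `betaSeq`, `fSeq`, `ASeq`, growth; 05 = §M.4–§M.5 increments, the limit `rhoA`, MEMBERSHIP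 `algUltraLiouville_rhoA`; 06 = §M.6–§M.7 degree certificate `finrank_adjoin_theta` / `adjoin_betaSeq_eq` + the number-field Liouville inequality (`FK`, `thetaF`, `sigma0`, norm to ℚ); 07 = §M.8–§M.9 the frame bound, the tower inequality, scale selection, `cert_arith`; 08 = §M.10–§M.11 THE POSITION CERTIFICATE `rhoA_far_from_degree_le` + EXCLUSIONS by tree names (`not_hyperLiouville_rhoA`, `not_quadHyperLiouville_rhoA`, `not_ultraLiouville_rhoA` / `'`, `not_liouvilleOrder_rhoA`, `transcendental_rhoA`); 09 = §C the cells `four_le_polarDeg_one_of_algUltra (hRoy)` (+ swap), the At-cells, the member cells at ρ_A, `rhoA_position`.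
PORT EDITS: the three `set_option linter.*` lines dropped and the one surfaced `unnecessarySimpa` fixed (`simpa using h12` ↦ `simp`, §R); 74 one-line docstrings added; two generic helpers made `private` (`three_mul_le_two_pow`, `half_identity`) with per-part private copies of those and of K's own private helpers; statements and proofs verbatim. `--supports stmt-Schanuel-24622`; no census credit carried; rung 0 — nothing here proves Schanuel.)
-/

noncomputable section

open Complex IntermediateField MvPolynomial

namespace Summit.Schanuel.Schanuel.Theorems.RootDecomp1BAlgFrame

open Summit.Schanuel.Schanuel.Theorems.RootDecomp1EPointTransfer (Roy2014_thm_1_1)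
open Summit.Schanuel.Schanuel.Theorems.RootDecomp1KHyper (mvlen mvlen_nonneg abs_coeff_le_mvlen one_le_mvlen)
open Summit.Schanuel.Schanuel.Theorems.RootDecomp1BHyperFrame (royDeg royS RoyNF roy_tree_iff framePt Ff
  Ff_eq_aeval exists_lipschitz_Ff linearIndependent_one_irrational)
open Summit.Schanuel.Schanuel.Theorems.RootDecomp1BQuadFrame (qy qe qpt qpt_apply framePt_qy_qe linearIndependent_qpt
  QuadHyperLiouville)
open Summit.Schanuel.Schanuel.Theorems.RootDecomp1BFedFlagCore (KleinIH polarDeg polarField)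
open Summit.Schanuel.Schanuel.Theorems.RootDecomp1BDefectFloorDefs (SharpRelativeLindemannAt TameDefectZeroAt
  WildSharpDefectZeroAt WildSharpDefectZeroInitAt WildSharpInitAt)
open Summit.Schanuel.Schanuel.Theorems.RootDecomp1BDefectFloorCells (natCast_le_trdeg_of_algebraicIndependent)
open Summit.Schanuel.Schanuel.Theorems.RootDecomp1BRadicalDescent (exists_int_relation)
open Summit.Schanuel.Schanuel.Theorems.RootDecomp1BMovingZero (mem_polarField_one mem_polarField_swap)

section Member

/-! ### §M.4 the increments and the limit `rhoA` -/

/-- `δ_K = β_{K+1} − β_K`. -/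
def delta (K : ℕ) : ℝ := betaSeq (K + 1) - betaSeq K

/-- `(θ_{K+1} − 1)/a_{K+1} < δ_K ≤ θ_{K+1}/a_{K+1}` — from the floor in `P_{K+1}`. -/
theorem delta_bounds (K : ℕ) :
    (theta (K + 1) - 1) / (aN (K + 1) : ℝ) < delta K ∧ delta K ≤ theta (K + 1) / (aN (K + 1) : ℝ) := by
  have ha := aNR_pos (K + 1)
  have hβ1 : betaSeq (K + 1) = ((Pseq (K + 1) : ℝ) + theta (K + 1)) / (aN (K + 1) : ℝ) := betaSeq_def _
  have hP : (Pseq (K + 1) : ℝ) = ⌊((aN (K + 1) : ℕ) : ℝ) * betaSeq K⌋₊ := by rw [Pseq_succ]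
  -- `β_K > 0`, so the floor behaves
  have hβpos : 0 < betaSeq K := by
    rw [betaSeq_def]; exact div_pos (by have := theta_pos K; positivity) (aNR_pos K)
  have hx : 0 ≤ ((aN (K + 1) : ℕ) : ℝ) * betaSeq K := by positivity
  have hfl1 : (⌊((aN (K + 1) : ℕ) : ℝ) * betaSeq K⌋₊ : ℝ) ≤ ((aN (K + 1) : ℕ) : ℝ) * betaSeq K :=
    Nat.floor_le hx
  have hfl2 : ((aN (K + 1) : ℕ) : ℝ) * betaSeq K < (⌊((aN (K + 1) : ℕ) : ℝ) * betaSeq K⌋₊ : ℝ) + 1 :=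
    Nat.lt_floor_add_one _
  have hδ : delta K = ((Pseq (K + 1) : ℝ) - (aN (K + 1) : ℝ) * betaSeq K + theta (K + 1)) / (aN (K + 1) : ℝ) := by
    unfold delta; rw [hβ1]; field_simp; ring
  constructor
  · rw [hδ, div_lt_div_iff_of_pos_right ha, hP]; linarith
  · rw [hδ, div_le_div_iff_of_pos_right ha, hP]; linarith

/-- The increments `δ_K = β_{K+1} − β_K` are positive. -/
theorem delta_pos (K : ℕ) : 0 < delta K := by
  have h := (delta_bounds K).1
  exact lt_trans (div_pos (by linarith [one_lt_theta (K + 1)]) (aNR_pos _)) h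

/-- `δ_K < 2/a_{K+1}`. -/
theorem delta_lt (K : ℕ) : delta K < 2 / (aN (K + 1) : ℝ) :=
  lt_of_le_of_lt (delta_bounds K).2 (div_lt_div_of_pos_right (theta_lt_two _) (aNR_pos _))

/-- `a_{j+K+1} ≥ 2^j a_{K+1}`. -/
theorem aNR_shift_ge (K j : ℕ) : (2 : ℝ) ^ j * (aN (K + 1) : ℝ) ≤ (aN (j + (K + 1)) : ℝ) := by
  rw [aNR_eq, aNR_eq, ← pow_add]
  exact pow_le_pow_right₀ (by norm_num) (by have := Nseq_add_le (K + 1) j; omega)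

/-- Geometric decay of the shifted increments. -/
theorem delta_shift_le (K j : ℕ) : delta (j + K) ≤ ((1 : ℝ) / 2) ^ j * (2 / (aN (K + 1) : ℝ)) := by
  have h1 := (delta_lt (j + K)).le
  have h2 := aNR_shift_ge K j
  have ha := aNR_pos (K + 1)
  rw [show j + K + 1 = j + (K + 1) by ring] at h1
  calc delta (j + K) ≤ 2 / (aN (j + (K + 1)) : ℝ) := h1
    _ ≤ 2 / ((2 : ℝ) ^ j * (aN (K + 1) : ℝ)) := div_le_div_of_nonneg_left (by norm_num) (by positivity) h2
    _ = ((1 : ℝ) / 2) ^ j * (2 / (aN (K + 1) : ℝ)) := by rw [one_div_pow]; field_simp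

/-- Geometric decay of the increments. -/
theorem delta_le_geom (K : ℕ) : delta K ≤ ((1 : ℝ) / 2) ^ K * (2 / (aN 1 : ℝ)) := by
  simpa using delta_shift_le 0 K

/-- The increments are summable. -/
theorem summable_delta : Summable delta :=
  Summable.of_nonneg_of_le (fun K => (delta_pos K).le) delta_le_geom (summable_geometric_two.mul_right _)

/-- **THE MEMBER** `rhoA = β_0 + Σ_K δ_K = lim β_K`. -/
def rhoA : ℝ := betaSeq 0 + ∑' K, delta K

/-- `β_K = β_0 + Σ_{j<K} δ_j`. -/
theorem betaSeq_eq_sum (K : ℕ) : betaSeq K = betaSeq 0 + ∑ j ∈ Finset.range K, delta j := by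
  unfold delta; rw [Finset.sum_range_sub]; ring

/-- The tail: `rhoA − β_K = Σ_j δ_{j+K}`. -/
theorem rhoA_sub_betaSeq (K : ℕ) : rhoA - betaSeq K = ∑' j, delta (j + K) := by
  rw [rhoA, betaSeq_eq_sum K, ← summable_delta.sum_add_tsum_nat_add K]; ring

/-- The shifted increments are summable. -/
theorem summable_delta_shift (K : ℕ) : Summable fun j => delta (j + K) :=
  (summable_nat_add_iff K).mpr summable_delta

/-- `0 < rhoA − β_K ≤ 4 / a_{K+1}`. -/
theorem rhoA_sub_betaSeq_pos (K : ℕ) : 0 < rhoA - betaSeq K := by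
  rw [rhoA_sub_betaSeq]
  exact (summable_delta_shift K).tsum_pos (fun j => (delta_pos _).le) 0 (delta_pos _)

/-- `ρ_A − β_K ≤ 4/a_{K+1}`. -/
theorem rhoA_sub_betaSeq_le (K : ℕ) : rhoA - betaSeq K ≤ 4 / (aN (K + 1) : ℝ) := by
  rw [rhoA_sub_betaSeq]
  have hgeom : Summable fun j : ℕ => ((1 : ℝ) / 2) ^ j * (2 / (aN (K + 1) : ℝ)) :=
    summable_geometric_two.mul_right _
  calc ∑' j, delta (j + K) ≤ ∑' j : ℕ, ((1 : ℝ) / 2) ^ j * (2 / (aN (K + 1) : ℝ)) :=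
        Summable.tsum_le_tsum (fun j => delta_shift_le K j) (summable_delta_shift K) hgeom
    _ = 4 / (aN (K + 1) : ℝ) := by rw [tsum_mul_right, tsum_geometric_two]; ring

/-- `|ρ_A − β_K| ≤ 4/a_{K+1}`. -/
theorem abs_rhoA_sub_betaSeq_le (K : ℕ) : |rhoA - betaSeq K| ≤ 4 / (aN (K + 1) : ℝ) := by
  rw [abs_of_pos (rhoA_sub_betaSeq_pos K)]; exact rhoA_sub_betaSeq_le K

/-- `0 < β_K < 1/256` and `0 < rhoA < 1/128`. -/
theorem betaSeq_pos (K : ℕ) : 0 < betaSeq K := by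
  rw [betaSeq_def]; exact div_pos (by have := theta_pos K; positivity) (aNR_pos K)

/-- `β_0 < 1/512`. -/
theorem betaSeq_zero_lt : betaSeq 0 < 1 / 512 := by
  rw [betaSeq_def, Pseq_zero, aN_zero]
  have := theta_lt_two 0
  push_cast
  rw [zero_add]
  calc theta 0 / 1024 < 2 / 1024 := div_lt_div_of_pos_right this (by norm_num)
    _ = 1 / 512 := by norm_num

/-- `ρ_A < 1/128`. -/
theorem rhoA_lt : rhoA < 1 / 128 := by
  have h1 := rhoA_sub_betaSeq_le 0
  have h2 : (4 : ℝ) / (aN 1 : ℝ) ≤ 4 / 1024 := by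
    apply div_le_div_of_nonneg_left (by norm_num) (by norm_num)
    exact_mod_cast le_aN 1
  have h3 := betaSeq_zero_lt
  linarith

/-- `0 < ρ_A`. -/
theorem rhoA_pos : 0 < rhoA := by linarith [rhoA_sub_betaSeq_pos 0, betaSeq_pos 0]

/-- `β_K < ρ_A`. -/
theorem betaSeq_lt_rhoA (K : ℕ) : betaSeq K < rhoA := by linarith [rhoA_sub_betaSeq_pos K]

/-- `β_K < 1/128`. -/
theorem betaSeq_lt (K : ℕ) : betaSeq K < 1 / 128 := (betaSeq_lt_rhoA K).trans rhoA_lt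

/-- `P_K < a_K` (indeed `P_K ≤ a_K / 128`). -/
theorem Pseq_le (K : ℕ) : (Pseq K : ℝ) ≤ (aN K : ℝ) := by
  have h := aN_mul_betaSeq K
  have h1 := betaSeq_lt K
  have h2 := theta_pos K
  have ha := aNR_pos K
  nlinarith

/-! ### §M.5 membership: `rhoA ∈ AlgUltraLiouville` -/

/-- `e < 3`. -/
private theorem exp_one_lt_three' : Real.exp 1 < 3 := by
  have := Real.exp_one_lt_d9; norm_num at this; linarith

/-- The rate: `4 / a_{K+1} < exp(−exp(A_K^{K+1}))`. -/
theorem four_div_aN_succ_lt (K : ℕ) :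
    4 / (aN (K + 1) : ℝ) < Real.exp (-Real.exp ((ASeq K : ℝ) ^ (K + 1))) := by
  obtain ⟨E, hE⟩ : ∃ E : ℕ, E = ASeq K ^ (K + 1) := ⟨_, rfl⟩
  have hER : ((ASeq K : ℝ) ^ (K + 1)) = (E : ℝ) := by rw [hE]; push_cast; ring
  rw [hER]
  -- `exp(E) ≤ 3^E`, `exp(3^E) < 4^{3^E}`, `a_{K+1} = 2^{2·3^E + 2} = 4 · 4^{3^E}`
  have h1 : Real.exp (E : ℝ) ≤ (3 : ℝ) ^ E := by
    rw [show (E : ℝ) = E * 1 by ring, Real.exp_nat_mul]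
    exact pow_le_pow_left₀ (Real.exp_pos 1).le exp_one_lt_three'.le E
  have h3E : (1 : ℕ) ≤ 3 ^ E := Nat.one_le_pow _ _ (by norm_num)
  have h2 : Real.exp ((3 : ℝ) ^ E) < (4 : ℝ) ^ (3 ^ E) := by
    have : Real.exp (((3 ^ E : ℕ) : ℝ)) < (4 : ℝ) ^ (3 ^ E) := by
      rw [show (((3 ^ E : ℕ) : ℝ)) = ((3 ^ E : ℕ) : ℝ) * 1 by ring, Real.exp_nat_mul]
      exact pow_lt_pow_left₀ (by linarith [exp_one_lt_three']) (Real.exp_pos 1).le (by omega)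
    simpa using this
  have haN : (aN (K + 1) : ℝ) = 4 * (4 : ℝ) ^ (3 ^ E) := by
    rw [aNR_eq, Nseq_succ, ← hE]
    rw [show 2 * 3 ^ E + 2 = 2 * (3 ^ E + 1) by ring, pow_mul]; norm_num; ring
  have hexp : Real.exp (Real.exp (E : ℝ)) < (4 : ℝ) ^ (3 ^ E) :=
    lt_of_le_of_lt (Real.exp_le_exp.mpr h1) h2
  have h4pos : (0 : ℝ) < (4 : ℝ) ^ 3 ^ E := by positivity
  have h4div : (4 : ℝ) / (4 * (4 : ℝ) ^ 3 ^ E) = ((4 : ℝ) ^ 3 ^ E)⁻¹ := by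
    field_simp
  rw [haN, h4div, Real.exp_neg, inv_lt_inv₀ h4pos (Real.exp_pos _)]
  exact hexp

/-- **`rhoA ∈ AlgUltraLiouville`** (hypothesis-free): level `m` is served by the frame `K = m`. -/
theorem algUltraLiouville_rhoA : AlgUltraLiouville rhoA := by
  intro m
  refine ⟨betaSeq m, fSeq m, ASeq m, le_ASeq m, irrational_betaSeq m, fSeq_ne_zero m,
    natDegree_fSeq_le_ASeq m, abs_coeff_fSeq_le m, aeval_betaSeq_fSeq m, ?_⟩
  have h1 := abs_rhoA_sub_betaSeq_le m
  have h2 := four_div_aN_succ_lt m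
  have hA1 : (1 : ℝ) ≤ ASeq m := by exact_mod_cast one_le_ASeq m
  have h3 : Real.exp (-Real.exp ((ASeq m : ℝ) ^ (m + 1))) ≤ Real.exp (-Real.exp ((ASeq m : ℝ) ^ m)) := by
    rw [Real.exp_le_exp, neg_le_neg_iff, Real.exp_le_exp]
    exact pow_le_pow_right₀ hA1 (Nat.le_succ m)
  exact lt_of_le_of_lt h1 (lt_of_lt_of_le h2 h3)

end Member

end Summit.Schanuel.Schanuel.Theorems.RootDecomp1BAlgFrame

end
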